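import Summits.Ventures.LatticeQCDFlow.Exactness.IMHMultiProposalExact
import HarnessLib

/-!
# Use every member of the batch: in stationarity the pool-weighted average `Σ_j w(z_j) f(z_j) / Σ_i w(z_i)` over the current state and
# the `n` fresh proposals has expectation EXACTLY `π f`, for every positive measurable weight

HONEST FRAMING: exact (Metropolis-corrected) sampling algorithms for lattice gauge theory;
figures of merit are autocorrelation/cost numbers at stated couplings and volumes; no
continuum-physics claim.

Venture `LatticeQCDFlow` (cell pub-lqcd), topic `Exactness`; FANOUT row 30 (lean-1, GEN-41).  NEW WORK of the cell, sequel of GEN-41's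
`IMHMultiProposalExact` (the pool-selection sampler with `n` fresh proposals is exact for `π = w·q` on a general state space; the pool `z = (x, y_1,
…, y_n)`, pool weight `W(z) = Σ_i w(z_i)`).  Practice evaluates `f` on the whole batch anyway; the Rao–Blackwellised ("waste-recycling", "use all
proposals") read-out replaces `f` at the selected member by the pool-weighted average `A_f(z) = Σ_j w(z_j) f(z_j)/W(z)`.  THIS FILE: under the
stationary law (`x ∼ π`, `y ∼ q^{⊗n}` independent) `E[A_f] = π f` EXACTLY — by the same transposition symmetry that gives detailed balance.

* §1 **`pool_fun_term_swap`** — for measurable `a, b ≥ 0`: `∫ a(z_0)w(z_0)·w(z_j)b(z_j)/W dq^{⊗(n+1)} = ∫ b(z_0)w(z_0)·w(z_j)a(z_j)/W dq^{⊗(n+1)}`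
  (GEN-41's `pool_term_swap` with functions in place of indicators).
* §2 **`multiProposal_poolAverage_lintegral_eq`** — `∫ (∫ Σ_j w(z_j)g(z_j)/W(z) dq^{⊗n}(y)) π(dx) = ∫ g dπ` for every measurable `g ≥ 0`
  (`ℝ≥0∞`; `measurable_cons_comp`, `lintegral_pi_succ_coord_zero` bookkeeping).
* §3 **`multiProposal_poolAverage_integral_eq`** — real form for a bounded measurable `0 ≤ f ≤ c`:
  `∫∫ Σ_j w(z_j)f(z_j)/W(z) dq^{⊗n} dπ = ∫ f dπ` (shift a general bounded observable by a constant first: the pool weights sum to one).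
Reading (gauge files): at equilibrium the batch sampler may report the weight-averaged observable over all `n + 1` configurations of the pool
instead of the selected one without bias — the selection noise is integrated out; combined with `IMHMultiProposalExact` (the selected state
stays `π`-distributed) this is the exact "use-all-proposals" estimator for flows.  NOT CLAIMED: its variance reduction (a Rao–Blackwell inequality
conditional on the pool, not typed); anything off equilibrium.  No `sorry`, no new definitions, nothing cited as a fact.
-/

noncomputable section

namespace Summit.Ventures.LatticeQCDFlow.Exactness

open MeasureTheory ProbabilityTheory Function Finset
open scoped ENNReal

variable {Ω : Type*} [MeasurableSpace Ω] {q : Measure Ω} [IsProbabilityMeasure q] {w : Ω → ℝ} {n : ℕ}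

/-! ## §1 The transposition symmetry with functions -/

/-- Measurability of `z ↦ a(z_0)·w(z_0)·(w(z_j)·b(z_j)/W(z))`. [ours, bookkeeping] -/
theorem measurable_poolFunTerm (hw : Measurable w) {a b : Ω → ℝ≥0∞} (ha : Measurable a) (hb : Measurable b) (j : Fin (n + 1)) :
    Measurable fun z : Fin (n + 1) → Ω => a (z 0) * ENNReal.ofReal (w (z 0)) *
      (ENNReal.ofReal (w (z j)) * b (z j) / ∑ i, ENNReal.ofReal (w (z i))) :=
  ((ha.comp (measurable_pi_apply 0)).mul (hw.ennreal_ofReal.comp (measurable_pi_apply 0))).mul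
    (((hw.ennreal_ofReal.comp (measurable_pi_apply j)).mul (hb.comp (measurable_pi_apply j))).div
      (Finset.measurable_sum _ fun i _ => hw.ennreal_ofReal.comp (measurable_pi_apply i)))

/-- **THE TRANSPOSITION SYMMETRY WITH FUNCTIONS**: `∫ a(z_0)w(z_0)·(w(z_j)b(z_j)/W) dq^{⊗(n+1)} = ∫ b(z_0)w(z_0)·(w(z_j)a(z_j)/W) dq^{⊗(n+1)}`. [ours] -/
theorem pool_fun_term_swap (hw : Measurable w) {a b : Ω → ℝ≥0∞} (ha : Measurable a) (hb : Measurable b) (j : Fin (n + 1)) :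
    ∫⁻ z, a (z 0) * ENNReal.ofReal (w (z 0)) * (ENNReal.ofReal (w (z j)) * b (z j) / ∑ i, ENNReal.ofReal (w (z i)))
        ∂(Measure.pi fun _ : Fin (n + 1) => q) =
      ∫⁻ z, b (z 0) * ENNReal.ofReal (w (z 0)) * (ENNReal.ofReal (w (z j)) * a (z j) / ∑ i, ENNReal.ofReal (w (z i)))
        ∂(Measure.pi fun _ : Fin (n + 1) => q) := by
  set σ : Equiv.Perm (Fin (n + 1)) := Equiv.swap 0 j with hσ
  set e := MeasurableEquiv.piCongrLeft (fun _ : Fin (n + 1) => Ω) σ with he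
  have hmp : MeasurePreserving e (Measure.pi fun _ : Fin (n + 1) => q) (Measure.pi fun _ : Fin (n + 1) => q) :=
    measurePreserving_piCongrLeft (fun _ : Fin (n + 1) => q) σ
  have h0 : ∀ z : Fin (n + 1) → Ω, e z 0 = z j := fun z => by
    rw [he, piCongrLeft_apply_eq, hσ, Equiv.symm_swap, Equiv.swap_apply_left]
  have hj : ∀ z : Fin (n + 1) → Ω, e z j = z 0 := fun z => by
    rw [he, piCongrLeft_apply_eq, hσ, Equiv.symm_swap, Equiv.swap_apply_right]
  have hW : ∀ z : Fin (n + 1) → Ω, ∑ i, ENNReal.ofReal (w (e z i)) = ∑ i, ENNReal.ofReal (w (z i)) := fun z =>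
    sum_weight_piCongrLeft σ z
  rw [← hmp.lintegral_comp (measurable_poolFunTerm hw ha hb j)]
  refine lintegral_congr fun z => ?_
  simp only [h0, hj, hW, div_eq_mul_inv]
  ring

/-! ## §2 The pool-weighted average is unbiased at equilibrium -/

/-- `(x, y) ↦ F(x ∷ y)` is measurable on `Ω × (Fin n → Ω)` for measurable `F`. [ours, bookkeeping] -/
theorem measurable_cons_comp {β : Type*} [MeasurableSpace β] {F : (Fin (n + 1) → Ω) → β} (hF : Measurable F) :
    Measurable fun p : Ω × (Fin n → Ω) => F (Fin.cons p.1 p.2) := by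
  set e := MeasurableEquiv.piFinSuccAbove (fun _ : Fin (n + 1) => Ω) 0 with he
  have h : (fun p : Ω × (Fin n → Ω) => F (Fin.cons p.1 p.2)) = F ∘ e.symm := by
    funext p
    simp [he, MeasurableEquiv.piFinSuccAbove_symm_apply, Fin.consEquiv]
  rw [h]
  exact hF.comp e.symm.measurable

/-- `∫ G(z_0) dq^{⊗(n+1)}(z) = ∫ G dq` for a function of the first coordinate only. [ours, bookkeeping] -/
theorem lintegral_pi_succ_coord_zero (q : Measure Ω) [IsProbabilityMeasure q] (n : ℕ) {G : Ω → ℝ≥0∞} (hG : Measurable G) :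
    ∫⁻ z, G (z 0) ∂(Measure.pi fun _ : Fin (n + 1) => q) = ∫⁻ x, G x ∂q := by
  rw [lintegral_pi_succ_eq_lintegral_cons q n (G := fun z => G (z 0)) (hG.comp (measurable_pi_apply 0))]
  simp only [Fin.cons_zero, lintegral_const, measure_univ, mul_one]

/-- **`E_{x∼π, y∼q^{⊗n}}[Σ_j w(z_j)g(z_j)/W(z)] = ∫ g dπ`** for every measurable `g ≥ 0` and every positive measurable weight (iterated form). [ours] -/
theorem multiProposal_poolAverage_lintegral_eq (hw : Measurable w) (hw0 : ∀ y, 0 < w y) {g : Ω → ℝ≥0∞} (hg : Measurable g) :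
    ∫⁻ x, ∫⁻ y, (∑ j, ENNReal.ofReal (w (Fin.cons (α := fun _ : Fin (n + 1) => Ω) x y j)) *
        g (Fin.cons (α := fun _ : Fin (n + 1) => Ω) x y j)) / (∑ i, ENNReal.ofReal (w (Fin.cons (α := fun _ : Fin (n + 1) => Ω) x y i)))
        ∂(Measure.pi fun _ : Fin n => q) ∂(q.withDensity fun x => ENNReal.ofReal (w x)) =
      ∫⁻ x, g x ∂(q.withDensity fun x => ENNReal.ofReal (w x)) := by
  set pin : Measure (Fin n → Ω) := Measure.pi fun _ : Fin n => q with hpin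
  set F : (Fin (n + 1) → Ω) → ℝ≥0∞ := fun z => (∑ j, ENNReal.ofReal (w (z j)) * g (z j)) / ∑ i, ENNReal.ofReal (w (z i)) with hF
  have hWm : Measurable fun z : Fin (n + 1) → Ω => ∑ i, ENNReal.ofReal (w (z i)) :=
    Finset.measurable_sum _ fun i _ => hw.ennreal_ofReal.comp (measurable_pi_apply i)
  have hNm : Measurable fun z : Fin (n + 1) → Ω => ∑ j, ENNReal.ofReal (w (z j)) * g (z j) :=
    Finset.measurable_sum _ fun j _ => (hw.ennreal_ofReal.comp (measurable_pi_apply j)).mul (hg.comp (measurable_pi_apply j))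
  have hFm : Measurable F := hNm.div hWm
  have hGm : Measurable fun z : Fin (n + 1) → Ω => ENNReal.ofReal (w (z 0)) * F z := (hw.ennreal_ofReal.comp (measurable_pi_apply 0)).mul hFm
  have hK : Measurable fun x => ∫⁻ y, F (Fin.cons x y) ∂pin := (measurable_cons_comp hFm).lintegral_prod_right'
  -- Step 1: the left side against `q^{⊗(n+1)}`
  have hL : ∫⁻ x, ∫⁻ y, F (Fin.cons x y) ∂pin ∂(q.withDensity fun x => ENNReal.ofReal (w x)) =
      ∫⁻ z, ENNReal.ofReal (w (z 0)) * F z ∂(Measure.pi fun _ : Fin (n + 1) => q) := by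
    rw [lintegral_withDensity_eq_lintegral_mul _ hw.ennreal_ofReal hK, lintegral_pi_succ_eq_lintegral_cons q n hGm]
    refine lintegral_congr fun x => ?_
    simp only [Pi.mul_apply, Fin.cons_zero]
    exact (lintegral_const_mul' _ _ ENNReal.ofReal_ne_top).symm
  -- Step 2: split over the pool, swap each term, recombine (`W/W = 1`)
  have hsplit : ∀ z : Fin (n + 1) → Ω, ENNReal.ofReal (w (z 0)) * F z =
      ∑ j, (1 : ℝ≥0∞) * ENNReal.ofReal (w (z 0)) * (ENNReal.ofReal (w (z j)) * g (z j) / ∑ i, ENNReal.ofReal (w (z i))) := fun z => by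
    simp only [hF, one_mul, div_eq_mul_inv, Finset.sum_mul, Finset.mul_sum]
  have hjoin : ∀ z : Fin (n + 1) → Ω, ∑ j, g (z 0) * ENNReal.ofReal (w (z 0)) * (ENNReal.ofReal (w (z j)) * 1 / ∑ i, ENNReal.ofReal (w (z i))) =
      g (z 0) * ENNReal.ofReal (w (z 0)) := fun z => by
    have hW := sum_weight_pos_ne_top hw0 z
    rw [← Finset.mul_sum]
    simp only [mul_one, div_eq_mul_inv, ← Finset.sum_mul, ENNReal.mul_inv_cancel hW.1 hW.2, mul_one]
  have hM : ∫⁻ z, ENNReal.ofReal (w (z 0)) * F z ∂(Measure.pi fun _ : Fin (n + 1) => q) =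
      ∫⁻ z, g (z 0) * ENNReal.ofReal (w (z 0)) ∂(Measure.pi fun _ : Fin (n + 1) => q) := by
    simp_rw [hsplit]
    rw [lintegral_finsetSum _ fun j _ => measurable_poolFunTerm hw measurable_const hg j]
    simp_rw [pool_fun_term_swap hw measurable_const hg]
    rw [← lintegral_finsetSum _ fun j _ => measurable_poolFunTerm hw hg measurable_const j]
    exact lintegral_congr fun z => hjoin z
  -- Step 3: integrate out the proposals and return to `π`
  have hR : ∫⁻ z, g (z 0) * ENNReal.ofReal (w (z 0)) ∂(Measure.pi fun _ : Fin (n + 1) => q) =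
      ∫⁻ x, g x ∂(q.withDensity fun x => ENNReal.ofReal (w x)) := by
    rw [lintegral_pi_succ_coord_zero q n (G := fun x => g x * ENNReal.ofReal (w x)) (hg.mul hw.ennreal_ofReal),
      lintegral_withDensity_eq_lintegral_mul _ hw.ennreal_ofReal hg]
    exact lintegral_congr fun x => by simp only [Pi.mul_apply]; ring
  exact (hL.trans hM).trans hR

/-! ## §3 The real-valued read-out -/

/-- **`∫∫ Σ_j w(z_j)f(z_j)/W(z) dq^{⊗n} dπ = ∫ f dπ`** for a bounded measurable `0 ≤ f ≤ c` (shift a general bounded observable by a constant: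
the pool weights sum to one). [ours] -/
theorem multiProposal_poolAverage_integral_eq (hw : Measurable w) (hw0 : ∀ y, 0 < w y)
    [IsProbabilityMeasure (q.withDensity fun x => ENNReal.ofReal (w x))] {f : Ω → ℝ} (hf : Measurable f) (hf0 : ∀ y, 0 ≤ f y)
    {c : ℝ} (hfc : ∀ y, f y ≤ c) :
    ∫ x, (∫⁻ y, (∑ j, ENNReal.ofReal (w (Fin.cons (α := fun _ : Fin (n + 1) => Ω) x y j)) *
        ENNReal.ofReal (f (Fin.cons (α := fun _ : Fin (n + 1) => Ω) x y j))) /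
        (∑ i, ENNReal.ofReal (w (Fin.cons (α := fun _ : Fin (n + 1) => Ω) x y i))) ∂(Measure.pi fun _ : Fin n => q)).toReal
        ∂(q.withDensity fun x => ENNReal.ofReal (w x)) =
      ∫ x, f x ∂(q.withDensity fun x => ENNReal.ofReal (w x)) := by
  set π : Measure Ω := q.withDensity fun x => ENNReal.ofReal (w x) with hπ
  set pin : Measure (Fin n → Ω) := Measure.pi fun _ : Fin n => q with hpin
  set F : (Fin (n + 1) → Ω) → ℝ≥0∞ := fun z => (∑ j, ENNReal.ofReal (w (z j)) * ENNReal.ofReal (f (z j))) / ∑ i, ENNReal.ofReal (w (z i))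
    with hF
  have hFm : Measurable F :=
    (Finset.measurable_sum _ fun j _ => (hw.ennreal_ofReal.comp (measurable_pi_apply j)).mul
      (hf.ennreal_ofReal.comp (measurable_pi_apply j))).div (Finset.measurable_sum _ fun i _ => hw.ennreal_ofReal.comp (measurable_pi_apply i))
  -- the pool average is at most `c`: `Σ_j w_j f_j ≤ c·W`
  have hFle : ∀ z, F z ≤ ENNReal.ofReal c := fun z => by
    have hW := sum_weight_pos_ne_top hw0 z
    rw [hF]
    refine (ENNReal.div_le_iff hW.1 hW.2).2 ?_
    rw [Finset.mul_sum]
    exact Finset.sum_le_sum fun j _ => by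
      rw [mul_comm]; exact mul_le_mul' (ENNReal.ofReal_le_ofReal (hfc _)) le_rfl
  have hK : Measurable fun x => ∫⁻ y, F (Fin.cons x y) ∂pin := (measurable_cons_comp hFm).lintegral_prod_right'
  have hKle : ∀ x, ∫⁻ y, F (Fin.cons x y) ∂pin ≤ ENNReal.ofReal c := fun x =>
    (lintegral_mono fun y => hFle _).trans (by rw [lintegral_const, measure_univ, mul_one])
  have hmain := multiProposal_poolAverage_lintegral_eq (q := q) (n := n) hw hw0 hf.ennreal_ofReal
  -- convert both sides to real integrals
  rw [integral_eq_lintegral_of_nonneg_ae (ae_of_all _ fun x => ENNReal.toReal_nonneg) hK.ennreal_toReal.aestronglyMeasurable,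
    integral_eq_lintegral_of_nonneg_ae (ae_of_all _ fun x => hf0 x) hf.aestronglyMeasurable]
  congr 1
  rw [← hmain]
  refine lintegral_congr fun x => ?_
  rw [ENNReal.ofReal_toReal (ne_top_of_le_ne_top ENNReal.ofReal_ne_top (hKle x))]

end Summit.Ventures.LatticeQCDFlow.Exactness
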